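import Summits.AtomisticToContinuum.HydrodynamicLimit.Theorems.RelayRaceLocalityConeLocalisationStubBubble
import HarnessLib

/-!
# RelayRaceLocality · ConeLocalisation — the floored glue, certified (what the restatement buys)

Support file for the crux item `stmt-AtomisticToContinuum-12504` (`ConeLocalisation`, route RelayRaceLocality of
`AtomisticToContinuum/HydrodynamicLimit`), line lead c3 (prover-line-stmt-AtomisticToContinuum-12504-c3-0,
2026-08-17). Pure logic on top of the LANDED floored crux
`ConeLocalisation.coneLocalisationFloored_holds : ConeLocalisationFloored` (p137065; line `Sketch`, all seven stubs).

Write `A := LightConeInLaw`, `B := NearConstantShortTimeHL`, `S` := the short-time guarded hydrodynamic limit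
(consequent of `ConeLocalisation`, antecedent of `RestartPrinciple`; NO density floor), `S♭ :=
ShortTimeGuardedHLFloored` (`S` with the guard `M⁻¹ ≤ ρ s x` inserted), `G := _root_.HydrodynamicLimit`
(the packing-guarded conjunct = consequent of `RestartPrinciple`). The tree knows `A → B → S♭` (p137065).
This file records, kernel-checked:

* `hydrodynamicLimit_of_restartPrincipleFloored : A → B → (S♭ → G) → G` — the route's deciding theorem with
  `RestartPrinciple`'s antecedent floored needs NO `ConeLocalisation` hypothesis at all: after restating
  stmt-12503 to `S♭ → G` the glue is `fun h₂ h₃ h₄ => h₄ (coneLocalisationFloored_holds h₂ h₃)`;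
* `closes_floored : GibbsLightCone → A → B → (S♭ → G) → ConeLocalisationFloored → G` — the same in the exact
  hypothesis shape of `RelayRaceLocality.closes` (both items floored, proof term `h₄ (h₅ h₂ h₃)` unchanged);
* `restartPrinciple_of_restartPrincipleFloored : (S♭ → G) → RestartPrinciple` — the floored restart item is the
  STRONGER statement (`S → S♭` by dropping a guard), so the restatement of stmt-12503 loses nothing the route uses;
* `coneLocalisation_iff_floorRemoval : ConeLocalisation ↔ (A → B → S♭ → S)` — what is LEFT of the item as typed:
  exactly density-floor removal under the two hypotheses (the provability gap of
  `Cruxes/ConeLocalisation/Disproof.lean` §3 and `Theorems/ConeLocalisation/Negative/FloorRemovalSchema.lean`).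
-/

noncomputable section

namespace Summit.AtomisticToContinuum.HydrodynamicLimit.Theorems.ConeLocalisation

open scoped Topology
open Filter Set MeasureTheory
open Literature.MathematicalPhysics.KineticTheory Literature.Analysis.FluidPDE
  Literature.Analysis.FunctionSpaces
open Summit.AtomisticToContinuum.HydrodynamicLimit.Theses.RelayRaceLocality

/-- `S → S♭`: the floored short-time guarded limit is formally weaker (drop the floor guard). -/
theorem shortTimeGuardedHLFloored_of_shortTimeGuardedHL
    (hS :
      (∃ η₀ : ℝ, 0 < η₀ ∧ ∀ M : ℝ, 0 < M → ∃ τ₁ : ℝ, 0 < τ₁ ∧ ∀ (a₀ θ₀ : T3 → ℝ) (u₀ : T3 → V3), Continuous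
      a₀ → Continuous θ₀ → Continuous u₀ → (∀ x, 0 < a₀ x) → (∀ x, 0 < θ₀ x) → ∃ σ₀ : ℝ, 0 < σ₀ ∧ ∀ σ : ℝ, 0
      < σ → σ < σ₀ → ∀ (T : ℝ) (ρ θ : ℝ → T3 → ℝ) (u : ℝ → T3 → V3), IsHardSphereEulerSolution σ T ρ u θ → ∀
      Φ : (N : ℕ) → HardSphereFlow (Torus.geometry (Fin 3)) (hsDiameter σ N) (N + 1), TendstoHydroFieldsAt
      (fun N => localGibbsLaw σ a₀ u₀ θ₀ N (Φ N)) Φ ρ u θ 0 → ∀ t ∈ Set.Ico 0 (min T τ₁), (∀ s ∈ Set.Icc 0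
      t, ∀ x, ρ s x * σ ^ 3 < η₀ ∧ ρ s x ≤ M ∧ θ s x ≤ M ∧ M⁻¹ ≤ θ s x ∧ ‖u s x‖ ≤ M ∧ ∀ i j k : Fin 3,
      |Torus.partialDeriv i (ρ s) x| ≤ M ∧ ‖Torus.partialDeriv i (u s) x‖ ≤ M ∧ |Torus.partialDeriv i (θ s)
      x| ≤ M ∧ |Torus.partialDeriv i (Torus.partialDeriv j (ρ s)) x| ≤ M ∧ ‖Torus.partialDeriv i
      (Torus.partialDeriv j (u s)) x‖ ≤ M ∧ |Torus.partialDeriv i (Torus.partialDeriv j (θ s)) x| ≤ M ∧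
      |Torus.partialDeriv i (Torus.partialDeriv j (Torus.partialDeriv k (ρ s))) x| ≤ M ∧ ‖Torus.partialDeriv
      i (Torus.partialDeriv j (Torus.partialDeriv k (u s))) x‖ ≤ M ∧ |Torus.partialDeriv i
      (Torus.partialDeriv j (Torus.partialDeriv k (θ s))) x| ≤ M) → TendstoHydroFieldsAt (fun N =>
      localGibbsLaw σ a₀ u₀ θ₀ N (Φ N)) Φ ρ u θ t)) :
    ShortTimeGuardedHLFloored := by
  obtain ⟨η₀, hη₀, H⟩ := hS
  refine ⟨η₀, hη₀, fun M hM => ?_⟩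
  obtain ⟨τ₁, hτ₁, H1⟩ := H M hM
  refine ⟨τ₁, hτ₁, fun a₀ θ₀ u₀ ha hθ hu ha0 hθ0 => ?_⟩
  obtain ⟨σ₀, hσ₀, H2⟩ := H1 a₀ θ₀ u₀ ha hθ hu ha0 hθ0
  refine ⟨σ₀, hσ₀, fun σ hσ hσ' T ρ θ u hE Φ h0 t ht hg => ?_⟩
  exact H2 σ hσ hσ' T ρ θ u hE Φ h0 t ht fun s hs x => ⟨(hg s hs x).1, (hg s hs x).2.1, (hg s hs x).2.2.2⟩

/-- **The deciding theorem after flooring `RestartPrinciple`'s antecedent needs no `ConeLocalisation`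
hypothesis**: `A → B → (S♭ → G) → G`, by the landed floored crux (p137065). -/
theorem hydrodynamicLimit_of_restartPrincipleFloored (h₂ : LightConeInLaw) (h₃ : NearConstantShortTimeHL)
    (h₄ : ShortTimeGuardedHLFloored → _root_.HydrodynamicLimit) : _root_.HydrodynamicLimit :=
  h₄ (coneLocalisationFloored_holds h₂ h₃)

/-- The route's `closes` with BOTH stmt-12503 (antecedent) and stmt-12504 (consequent) floored: same hypothesis
shape, same proof term `h₄ (h₅ h₂ h₃)`; and `h₅` is dischargeable by `coneLocalisationFloored_holds`. -/
theorem closes_floored (_h₁ : GibbsLightCone) (h₂ : LightConeInLaw) (h₃ : NearConstantShortTimeHL)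
    (h₄ : ShortTimeGuardedHLFloored → _root_.HydrodynamicLimit) (h₅ : ConeLocalisationFloored) :
    _root_.HydrodynamicLimit :=
  h₄ (h₅ h₂ h₃)

/-- **The floored restart item implies the restart item as typed**: `(S♭ → G) → RestartPrinciple`
(`RestartPrinciple` is literally `S → G`, and `S → S♭`). Restating stmt-12503 with the floor STRENGTHENS it. -/
theorem restartPrinciple_of_restartPrincipleFloored
    (h : ShortTimeGuardedHLFloored → _root_.HydrodynamicLimit) : RestartPrinciple :=
  fun hS => h (shortTimeGuardedHLFloored_of_shortTimeGuardedHL hS)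

/-- **What is left of `ConeLocalisation` as typed**: given the landed `A → B → S♭`, the item is equivalent to
density-floor removal under its two hypotheses, `A → B → S♭ → S`. -/
theorem coneLocalisation_iff_floorRemoval :
    ConeLocalisation ↔
    (LightConeInLaw → NearConstantShortTimeHL → ShortTimeGuardedHLFloored →
      (∃ η₀ : ℝ, 0 < η₀ ∧ ∀ M : ℝ, 0 < M → ∃ τ₁ : ℝ, 0 < τ₁ ∧ ∀ (a₀ θ₀ : T3 → ℝ) (u₀ : T3 → V3), Continuous
      a₀ → Continuous θ₀ → Continuous u₀ → (∀ x, 0 < a₀ x) → (∀ x, 0 < θ₀ x) → ∃ σ₀ : ℝ, 0 < σ₀ ∧ ∀ σ : ℝ, 0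
      < σ → σ < σ₀ → ∀ (T : ℝ) (ρ θ : ℝ → T3 → ℝ) (u : ℝ → T3 → V3), IsHardSphereEulerSolution σ T ρ u θ → ∀
      Φ : (N : ℕ) → HardSphereFlow (Torus.geometry (Fin 3)) (hsDiameter σ N) (N + 1), TendstoHydroFieldsAt
      (fun N => localGibbsLaw σ a₀ u₀ θ₀ N (Φ N)) Φ ρ u θ 0 → ∀ t ∈ Set.Ico 0 (min T τ₁), (∀ s ∈ Set.Icc 0
      t, ∀ x, ρ s x * σ ^ 3 < η₀ ∧ ρ s x ≤ M ∧ θ s x ≤ M ∧ M⁻¹ ≤ θ s x ∧ ‖u s x‖ ≤ M ∧ ∀ i j k : Fin 3,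
      |Torus.partialDeriv i (ρ s) x| ≤ M ∧ ‖Torus.partialDeriv i (u s) x‖ ≤ M ∧ |Torus.partialDeriv i (θ s)
      x| ≤ M ∧ |Torus.partialDeriv i (Torus.partialDeriv j (ρ s)) x| ≤ M ∧ ‖Torus.partialDeriv i
      (Torus.partialDeriv j (u s)) x‖ ≤ M ∧ |Torus.partialDeriv i (Torus.partialDeriv j (θ s)) x| ≤ M ∧
      |Torus.partialDeriv i (Torus.partialDeriv j (Torus.partialDeriv k (ρ s))) x| ≤ M ∧ ‖Torus.partialDeriv
      i (Torus.partialDeriv j (Torus.partialDeriv k (u s))) x‖ ≤ M ∧ |Torus.partialDeriv i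
      (Torus.partialDeriv j (Torus.partialDeriv k (θ s))) x| ≤ M) → TendstoHydroFieldsAt (fun N =>
      localGibbsLaw σ a₀ u₀ θ₀ N (Φ N)) Φ ρ u θ t)) := by
  constructor
  · intro h hA hB _
    exact h hA hB
  · intro h hA hB
    exact h hA hB (coneLocalisationFloored_holds hA hB)

end Summit.AtomisticToContinuum.HydrodynamicLimit.Theorems.ConeLocalisation

end
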